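import Summits.BirchSwinnertonDyer.BirchSwinnertonDyer.Theorems.PrintCf2SplitBadTwoLineResLocalDefectSevenModEight
import Summits.BirchSwinnertonDyer.BirchSwinnertonDyer.Theorems.PrintCf2SplitBadTwoStrictDatumOfDatumEq
import HarnessLib

/-!
# Road α, crux `PrintCf2.SplitBadTwoRankOneOfFacts` (stmt-BirchSwinnertonDyer-20368), stub S3d `stub_strictDefectAtVbar_two` (v12) ON THE CLASS
# `d ≡ 7 (mod 8)`: the strict defect at `v̄` VANISHES — `e_δ(1, 7) = 0`

Cell `bsd-print-cf2`, width seat `bsd-line-cf2-p1-w6` g4 (S3d (DEF) half); `--supports stmt-BirchSwinnertonDyer-20368 --as helper`. HONEST FRAMING: a PER-CLASS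
instance of the registered stub's conclusion (the stub quantifies one class function `eδ` over all classes; this file supplies the value `0` on
`d ≡ 7 (mod 8)` with its proof); nothing here closes the crux or the registered stub; no summit statement is proved by this seat; BSD is not proved by
any of this. No definition, no named fact, no `sorry`.

* **`strictDefectAtVbar_two_of_frame_seven`** — the body of `stub_strictDefectAtVbar_two` with its binders VERBATIM (member block `d, hd0, hsq, hd4, W, C, hC,
  hrank, hsha, K, hK, v, vbar, hv, hvbar, hne, π, hπ, r, hr, hpin, κ', hκ', γ', hγ', P, c₀, ℓ, hP, hgen, hc₀, hker, hlog, Dnr, n', H', hfin, htors, hch, hH0,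
  hn'`) plus `hd8 : d % 8 = 7`, concluding `∃ D n, Module.Finite Λ D.X ∧ D.HasCharValuationAt n ∧ (n' : ℤ) = n + 0`: on these frames
  `S_{W*}(K*_∞) = 𝔖_v̄(K*_∞, W*)` (`LineLocallyTrivial.datumSelmer_eq_restrictedSelmerZp_of_frame`, from Def(v̄) = 0, Def(w ∤ 2) = 0, no archimedean
  condition), so the GV datum IS a restricted datum with the same module (`StrictDefect.exists_restrictedDualData_hasCharValuationAt_of_datumSelmerInfty_eq`).
  Most binders of the stub (rank, Ш, generator, `γ'`) are not used by the proof — they are kept so that the final assembly is a one-line case split.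

presearch: Agboola 2007 §3 Prop. 3.2 / Thm. 3.1 (strict vs unramified over the line), Greenberg–Vatsal 2000 §2 — held; no new fact. beyond-print theorem: no.

References: [Agboola2007] §3 Prop. 3.2, Thm. 3.1; [GreenbergVatsal2000] §2 pp. 17–21; [GreenbergLNM1716] §3.
-/

noncomputable section

open scoped Classical

set_option linter.dupNamespace false
set_option autoImplicit false

open NumberField IsDedekindDomain Field WeierstrassCurve
open Literature.NumberTheory.EllipticCurves Literature.NumberTheory.EllipticCurves.GreenbergSelmer
open Literature.NumberTheory.EllipticCurves.GreenbergVatsal2000 Literature.NumberTheory.EllipticCurves.Castella2018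
open Literature.NumberTheory.EllipticCurves.Agboola2007
open Literature.NumberTheory.GaloisRepresentations
open Summit.BirchSwinnertonDyer.BirchSwinnertonDyer.Theorems.PrintCf2.LineLocallyTrivial

namespace Summit.BirchSwinnertonDyer.BirchSwinnertonDyer.Theorems.PrintCf2.StrictDefect

/-- **S3d on `d ≡ 7 (mod 8)`: `e_δ = 0`.** The conclusion of `stub_strictDefectAtVbar_two` (v12), binders verbatim plus `hd8 : d % 8 = 7`, with the
defect `0`: the Greenberg–Vatsal group and Agboola's restricted group over the line `K*_∞` coincide on these frames, so every `Λ`-dual datum of the former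
with `ch = (H')`, `H'(0) ≠ 0`, `v(H'(0)) = n'` yields a restricted dual datum with `HasCharValuationAt n'`.
[cite: Agboola2007, §3 Prop. 3.2 and Thm. 3.1] [cite: GreenbergVatsal2000, §2 pp. 17–21] -/
theorem strictDefectAtVbar_two_of_frame_seven
    (d : ℤ) (hd0 : d ≠ 0) (_hsq : Squarefree d) (_hd4 : d % 4 ≠ 1) (hd8 : d % 8 = 7)
    (W : WeierstrassCurve ℚ) [W.IsElliptic] [W.IsGloballyMinimal] (C : VariableChange ℚ)
    (hC : C • W = cm7.quadraticTwist (d : ℚ)) (_hrank : W.analyticRank = 1) (_hsha : Finite W.sha)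
    (K : Type) [Field K] [NumberField K] (hK : IsImaginaryQuadratic K)
    (v vbar : HeightOneSpectrum (𝓞 K)) (hv : ((2 : ℕ) : 𝓞 K) ∈ v.asIdeal) (hvbar : ((2 : ℕ) : 𝓞 K) ∈ vbar.asIdeal) (hne : vbar ≠ v)
    (π : (W.baseChange K).endRing) (hπ : (π : AddMonoid.End (W.baseChange K).geomPoints) * π = π - 2)
    (r : ℤ_[2]) (hr : r * r = r - 2)
    (hpin : ∀ τ ∈ GreenbergSelmer.inertia v, ∀ x : ↥((W.baseChange K).endEigenPrimaryTorsion 2 π r), τ • x = x ∨ τ • x = -x)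
    (κ' : ZpExtension K 2) (hκ' : κ'.IsUnramifiedOutside vbar) (γ' : absoluteGaloisGroup K) (_hγ' : κ'.IsTopGenerator γ')
    (P : W.toAffine.Point) (c₀ : ℕ) (ℓ : ℤ) (_hP : ¬ IsOfFinAddOrder P)
    (_hgen : ∀ R : W.toAffine.Point, ∃ (k : ℤ) (T : W.toAffine.Point), IsOfFinAddOrder T ∧ R = k • P + T)
    (_hc₀ : c₀ ≠ 0) (_hker : (W.baseChange ℚ_[2]).IsInReductionKernel (c₀ • W.toPadicPoint 2 P))
    (_hlog : ‖(W.baseChange ℚ_[2]).padicLogPoint (c₀ • W.toPadicPoint 2 P) / (c₀ : ℚ_[2])‖ = (2 : ℝ) ^ (-ℓ))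
    (Dnr : GreenbergVatsal2000.DatumDualData κ' γ' ↥((W.baseChange K).endEigenPrimaryTorsion 2 π r)
        (Castella2018.AcSelmer.bdpData ↥((W.baseChange K).endEigenPrimaryTorsion 2 π r) 2 vbar) ∅) (n' : ℕ) (H' : IwasawaAlgebra 2)
    (hfin : Module.Finite (IwasawaAlgebra 2) Dnr.X) (htors : Module.IsTorsion (IwasawaAlgebra 2) Dnr.X)
    (hch : Module.charIdeal (IwasawaAlgebra 2) Dnr.X = Ideal.span {H'}) (hH0 : PowerSeries.constantCoeff H' ≠ 0)
    (hn' : (PowerSeries.constantCoeff H').valuation = n') :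
    ∃ (D : Agboola2007.RestrictedDualData κ' ↥((W.baseChange K).endEigenPrimaryTorsion 2 π r) vbar γ') (n : ℕ),
      Module.Finite (IwasawaAlgebra 2) D.X ∧ D.HasCharValuationAt n ∧ (n' : ℤ) = n + 0 := by
  haveI : Fact (Nat.Prime 2) := ⟨Nat.prime_two⟩
  have heq : datumSelmerInfty κ' ↥((W.baseChange K).endEigenPrimaryTorsion 2 π r)
        (Castella2018.AcSelmer.bdpData ↥((W.baseChange K).endEigenPrimaryTorsion 2 π r) 2 vbar) ∅ =
      restrictedSelmerZp κ' ↥((W.baseChange K).endEigenPrimaryTorsion 2 π r) vbar := by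
    rw [datumSelmerInfty_eq]
    exact datumSelmer_eq_restrictedSelmerZp_of_frame hd0 hd8 W C hC hK v vbar hv hvbar hne π hπ hr hpin κ' hκ'
  exact exists_restrictedDualData_hasCharValuationAt_of_datumSelmerInfty_eq heq Dnr n' H' hfin htors hch hH0 hn'

end Summit.BirchSwinnertonDyer.BirchSwinnertonDyer.Theorems.PrintCf2.StrictDefect

end
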